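import Summits.ValiantsHypothesis.ValiantsHypothesis.Theorems.PolyaContinuedMonotoneCoverHardGradedCutExists
import Summits.ValiantsHypothesis.ValiantsHypothesis.Theorems.PolyaContinuedMonotoneCoverHardStubRectangleBound

/-!
# Crux `MonotoneCoverHard` (stmt-ValiantsHypothesis-7421): the crux HOLDS for GRADED covers —
every graded label-bijective cover of `per_n` has `m² ≥ 2^(n/3)`

First honest rung of the crux, in kernel (val-width-7421-p2 g0, 2026-08-27; assembles this seat's
graded-cut theorem `exists_balanced_cut_card_le_sq_of_graded` with the seat val-width-7421-p1's landed
stub `MonotoneCoverHardRectangle.stub_rectangleBound` and its label-extraction lemmas).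

A cover `(m, E, a)` of `per_n` (labels `a e ∈ {X j, 0, 1}`, `per_n = aeval a PM_E`) is GRADED by a
level function `g : Fin m ⊕ Fin m → ℕ` if along every nonzero edge the column level is the row level
plus `[the label is a variable]` (`hvar`, `hone`) and every weight-nonzero perfect matching has exactly
one variable edge with row endpoint on each level `ℓ < n` (`hlev`).  Every algebraic-branching-program /
layered-DAG / decision-tree cover (Grenet's `2^n − 1` cover, the permutation decision tree, disjoint
monomial paths, …) is graded with `g =` number of variable edges read before the node — i.e. every
label-bijective cover of the permanent written down so far.

* `eq_of_agree_on_var` — LABEL-INJECTIVITY in the form the graded-cut theorem consumes: two weight-nonzero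
  perfect matchings that agree on every row where either has a variable edge are equal (from p1's
  `label_bijection`: the identity `per_n = aeval a PM_E` has coefficients `≤ 1`).
* `two_pow_le_mul_self_of_graded` — **`2^(n/3) ≤ m·m` for every graded cover with `2 ≤ n`**: the layer
  cut at `h = ⌈n/2⌉` is balanced with `≤ m²` states (this seat) and every balanced cut has `≥ 2^(n/3)`
  states (`stub_rectangleBound`, p1).  This is the monotone-ABP width lower bound for the permanent
  (Nisan / Jerrum–Snir type) in the cover language; the Pfaffian signing is not used.
* `no_quasipolynomial_graded_cover` — hence the crux statement `MonotoneCoverHard` with the extra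
  conjunct "the cover is graded" inside the purported family: **no quasi-polynomial family of graded
  label-bijective Pfaffian covers of the permanent exists** (polylog vs. linear arithmetic).

Calibration: this settles the crux on the class of all KNOWN covers and isolates its open content — non-
graded (genuinely cyclic) Pfaffian matching structure — exactly as the line card's "rectangles from
cuts" mechanism intends; it is NOT the crux (general Pfaffian covers) and VP ≠ VNP is not moved.
No definitions are introduced.
-/

namespace Summit.ValiantsHypothesis.ValiantsHypothesis.Theorems.PolyaContinuedMonotoneCoverHard

-- summit = sub-problem name (single-conjunct summit, D-0017 layout), so the namespace repeats it
set_option linter.dupNamespace false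

open scoped Classical
open Finset
open Summit.ValiantsHypothesis.ValiantsHypothesis.Theorems.PolyaContinued.MonotoneCoverHardRectangle
  (exists_labels aeval_permanent_cover perPoly_eq_sum_monomial label_bijection pexp_injective
    stub_rectangleBound)

/-- **Label-injectivity.**  In a cover of `per_n` (labels in `{X j, 0, 1}`, `per_n = aeval a PM_E`),
two weight-nonzero perfect matchings that agree on every row at which either of them carries a
variable-labelled edge are equal: their label exponents coincide termwise (rows without variables
contribute `0`), and the exponent map is injective on weight-nonzero matchings because the identity
`per_n = aeval a PM_E` equates two sums of coefficient-`1` monomials (`label_bijection`). -/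
theorem eq_of_agree_on_var {m n : ℕ} (E : Finset (Fin m × Fin m))
    (a : Fin m × Fin m → MvPolynomial (Fin n × Fin n) ℂ)
    (ha : ∀ e, (∃ j, a e = MvPolynomial.X j) ∨ a e = 0 ∨ a e = 1)
    (hper : Literature.Computability.AlgebraicComplexity.perPoly (Fin n) ℂ =
      MvPolynomial.aeval a (Matrix.of fun i j => if (i, j) ∈ E then MvPolynomial.X (i, j) else 0 :
          Matrix (Fin m) (Fin m) (MvPolynomial (Fin m × Fin m) ℂ)).permanent)
    (τ τ' : Equiv.Perm (Fin m)) (hτ : ∀ i, (i, τ i) ∈ E ∧ a (i, τ i) ≠ 0)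
    (hτ' : ∀ i, (i, τ' i) ∈ E ∧ a (i, τ' i) ≠ 0)
    (h : ∀ i, ((∃ k, a (i, τ i) = MvPolynomial.X k) ∨ (∃ k, a (i, τ' i) = MvPolynomial.X k)) →
      τ i = τ' i) :
    τ = τ' := by
  obtain ⟨δ, hδ, -, hδ0⟩ := exists_labels a ha
  set G := Finset.univ.filter fun τ : Equiv.Perm (Fin m) => ∀ i, (i, τ i) ∈ E ∧ a (i, τ i) ≠ 0
    with hG
  have hsum : ∑ τ ∈ G, MvPolynomial.monomial (∑ i, δ (i, τ i)) (1 : ℂ) =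
      ∑ σ : Equiv.Perm (Fin n), MvPolynomial.monomial (∑ k, Finsupp.single (k, σ k) 1) (1 : ℂ) := by
    rw [← aeval_permanent_cover E a δ hδ G hG, ← hper, perPoly_eq_sum_monomial]
  obtain ⟨hinj, -, -⟩ := label_bijection G (fun τ => ∑ i, δ (i, τ i))
    (fun σ : Equiv.Perm (Fin n) => ∑ k, Finsupp.single (k, σ k) (1 : ℕ)) pexp_injective hsum
  have hτG : τ ∈ G := by rw [hG]; exact Finset.mem_filter.2 ⟨Finset.mem_univ _, hτ⟩
  have hτG' : τ' ∈ G := by rw [hG]; exact Finset.mem_filter.2 ⟨Finset.mem_univ _, hτ'⟩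
  refine hinj τ hτG τ' hτG' (Finset.sum_congr rfl fun i _ => ?_)
  rcases Classical.em ((∃ k, a (i, τ i) = MvPolynomial.X k) ∨ (∃ k, a (i, τ' i) = MvPolynomial.X k))
    with hv | hv
  · rw [h i hv]
  · rw [not_or] at hv
    rw [hδ0 _ hv.1, hδ0 _ hv.2]

/-- **The crux on graded covers, quantitative form: `2^(n/3) ≤ m · m`.**  For a label-bijective
Pfaffian cover of `per_n` (`2 ≤ n`) on `m + m` vertices graded by `g`, the layer cut at height
`⌈n/2⌉` is balanced with at most `m·m` crossing states (`exists_balanced_cut_card_le_sq_of_graded`,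
label-injectivity from `eq_of_agree_on_var`), while every balanced cut has at least `2^(n/3)` states
(`stub_rectangleBound`).  The Pfaffian signing is carried only because the registered stub quantifies
it; neither half uses it. -/
theorem two_pow_le_mul_self_of_graded (n m : ℕ) (hn : 2 ≤ n) (E : Finset (Fin m × Fin m))
    (a : Fin m × Fin m → MvPolynomial (Fin n × Fin n) ℂ)
    (hsig : ∃ s : Fin m × Fin m → ℂ, (∀ e, s e = 1 ∨ s e = -1) ∧
      (Matrix.of fun i j => if (i, j) ∈ E then MvPolynomial.C (s (i, j)) * MvPolynomial.X (i, j)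
          else 0 : Matrix (Fin m) (Fin m) (MvPolynomial (Fin m × Fin m) ℂ)).det =
        (Matrix.of fun i j => if (i, j) ∈ E then MvPolynomial.X (i, j) else 0 :
          Matrix (Fin m) (Fin m) (MvPolynomial (Fin m × Fin m) ℂ)).permanent)
    (ha : ∀ e, (∃ j, a e = MvPolynomial.X j) ∨ a e = 0 ∨ a e = 1)
    (hper : Literature.Computability.AlgebraicComplexity.perPoly (Fin n) ℂ =
      MvPolynomial.aeval a (Matrix.of fun i j => if (i, j) ∈ E then MvPolynomial.X (i, j) else 0 :
          Matrix (Fin m) (Fin m) (MvPolynomial (Fin m × Fin m) ℂ)).permanent)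
    (g : Fin m ⊕ Fin m → ℕ)
    (hvar : ∀ i j, (i, j) ∈ E → (∃ k, a (i, j) = MvPolynomial.X k) →
      g (Sum.inr j) = g (Sum.inl i) + 1)
    (hone : ∀ i j, (i, j) ∈ E → a (i, j) ≠ 0 → (¬ ∃ k, a (i, j) = MvPolynomial.X k) →
      g (Sum.inr j) = g (Sum.inl i))
    (hlev : ∀ τ : Equiv.Perm (Fin m), (∀ i, (i, τ i) ∈ E ∧ a (i, τ i) ≠ 0) →
      ∀ ℓ, ℓ < n → ∃! i : Fin m, (∃ k, a (i, τ i) = MvPolynomial.X k) ∧ g (Sum.inl i) = ℓ) :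
    2 ^ (n / 3) ≤ m * m := by
  obtain ⟨S, hbal, hcard⟩ := exists_balanced_cut_card_le_sq_of_graded n hn E a g hvar hone hlev
    (fun τ τ' hτ hτ' h => eq_of_agree_on_var E a ha hper τ τ' hτ hτ' h)
  -- the generic graded-cut theorem was elaborated with classical decidability instances for a
  -- general coefficient ring; `convert` bridges the (propositionally equal) `Finset.filter` instances
  have hlow := stub_rectangleBound n m E a hsig ha hper S (fun τ hτ => by convert hbal τ hτ)
  refine hlow.trans ?_
  convert hcard
  rfl

/-- `polylog < linear`, the instance needed below: `6 (t + c)^c + 3 ≤ 2^t` at `t = 4K² + 8K + 4`,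
`K = c + 1` (cf. the strategist's `polylog_lt_linear` in the line skeleton; re-proved here because
`Cruxes/` workfiles are not importable). -/
theorem six_mul_pow_add_three_le_two_pow (c : ℕ) :
    6 * (4 * (c + 1) * (c + 1) + 8 * (c + 1) + 4 + c) ^ c + 3 ≤
      2 ^ (4 * (c + 1) * (c + 1) + 8 * (c + 1) + 4) := by
  set K := c + 1 with hK
  set t := 4 * K * K + 8 * K + 4 with ht
  -- t + K ≤ (2K+3)² ≤ 2^(4K+6)
  have h1 : t + K ≤ (2 * K + 3) * (2 * K + 3) := by rw [ht]; nlinarith [Nat.zero_le K]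
  have h2 : 2 * K + 3 ≤ 2 ^ (2 * K + 3) := (Nat.lt_two_pow_self).le
  have h3 : t + K ≤ 2 ^ (4 * K + 6) := by
    calc t + K ≤ (2 * K + 3) * (2 * K + 3) := h1
      _ ≤ 2 ^ (2 * K + 3) * 2 ^ (2 * K + 3) := Nat.mul_le_mul h2 h2
      _ = 2 ^ (4 * K + 6) := by rw [← pow_add]; ring_nf
  have h4 : (t + K) ^ K ≤ 2 ^ ((4 * K + 6) * K) := by
    calc (t + K) ^ K ≤ (2 ^ (4 * K + 6)) ^ K := Nat.pow_le_pow_left h3 K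
      _ = 2 ^ ((4 * K + 6) * K) := by rw [← pow_mul]
  have h5 : (4 * K + 6) * K + 3 ≤ t := by rw [ht]; nlinarith [Nat.zero_le K]
  -- (t + c)^c * (t + c) ≤ (t+K)^K, and t + c ≥ 16
  have htc : 16 ≤ t + c := by rw [ht]; nlinarith [Nat.zero_le K]
  have h6 : (t + c) ^ c * (t + c) ≤ (t + K) ^ K := by
    rw [← pow_succ, hK]
    exact Nat.pow_le_pow_left (by omega) _
  have h7 : 6 * (t + c) ^ c + 3 ≤ (t + c) ^ c * (t + c) := by
    have hp : 1 ≤ (t + c) ^ c := Nat.one_le_pow _ _ (by omega)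
    nlinarith
  calc 6 * (t + c) ^ c + 3 ≤ (t + c) ^ c * (t + c) := h7
    _ ≤ (t + K) ^ K := h6
    _ ≤ 2 ^ ((4 * K + 6) * K) := h4
    _ ≤ 2 ^ t := Nat.pow_le_pow_right Nat.two_pos (by omega)

/-- **No quasi-polynomial family of GRADED label-bijective Pfaffian covers of the permanent.**  This is
the crux `MonotoneCoverHard` with the conjunct "graded by some level function `g`" added inside the
purported cover family — i.e. the crux restricted to the class of all currently known covers
(ABP / layered-DAG / decision-tree covers).  Proof: at `n = 2^t`, `t = 4(c+1)² + 8(c+1) + 4`,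
`two_pow_le_mul_self_of_graded` gives `2^(n/3) ≤ m² ≤ 2^(2 (t + c)^c)`, against
`6 (t + c)^c + 3 ≤ 2^t` (`six_mul_pow_add_three_le_two_pow`). -/
theorem no_quasipolynomial_graded_cover :
    ¬ ∃ c : ℕ, ∀ n : ℕ, ∃ m : ℕ, m ≤ 2 ^ ((Nat.log 2 n + c) ^ c) ∧
      ∃ (E : Finset (Fin m × Fin m)) (a : Fin m × Fin m → MvPolynomial (Fin n × Fin n) ℂ),
        (∃ s : Fin m × Fin m → ℂ, (∀ e, s e = 1 ∨ s e = -1) ∧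
          (Matrix.of fun i j => if (i, j) ∈ E then MvPolynomial.C (s (i, j)) * MvPolynomial.X (i, j)
              else 0 : Matrix (Fin m) (Fin m) (MvPolynomial (Fin m × Fin m) ℂ)).det =
            (Matrix.of fun i j => if (i, j) ∈ E then MvPolynomial.X (i, j) else 0 :
              Matrix (Fin m) (Fin m) (MvPolynomial (Fin m × Fin m) ℂ)).permanent) ∧
        (∀ e, (∃ j, a e = MvPolynomial.X j) ∨ a e = 0 ∨ a e = 1) ∧
        Literature.Computability.AlgebraicComplexity.perPoly (Fin n) ℂ =
          MvPolynomial.aeval a (Matrix.of fun i j => if (i, j) ∈ E then MvPolynomial.X (i, j) else 0 :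
              Matrix (Fin m) (Fin m) (MvPolynomial (Fin m × Fin m) ℂ)).permanent ∧
        ∃ g : Fin m ⊕ Fin m → ℕ,
          (∀ i j, (i, j) ∈ E → (∃ k, a (i, j) = MvPolynomial.X k) →
            g (Sum.inr j) = g (Sum.inl i) + 1) ∧
          (∀ i j, (i, j) ∈ E → a (i, j) ≠ 0 → (¬ ∃ k, a (i, j) = MvPolynomial.X k) →
            g (Sum.inr j) = g (Sum.inl i)) ∧
          (∀ τ : Equiv.Perm (Fin m), (∀ i, (i, τ i) ∈ E ∧ a (i, τ i) ≠ 0) →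
            ∀ ℓ, ℓ < n → ∃! i : Fin m, (∃ k, a (i, τ i) = MvPolynomial.X k) ∧ g (Sum.inl i) = ℓ) := by
  rintro ⟨c, hc⟩
  set t := 4 * (c + 1) * (c + 1) + 8 * (c + 1) + 4 with ht
  obtain ⟨m, hm, E, a, hsig, ha, hper, g, hvar, hone, hlev⟩ := hc (2 ^ t)
  have ht2 : 2 ≤ t := by rw [ht]; nlinarith
  have hn : 2 ≤ 2 ^ t :=
    le_trans ht2 (Nat.lt_two_pow_self).le
  have hlow := two_pow_le_mul_self_of_graded (2 ^ t) m hn E a hsig ha hper g hvar hone hlev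
  have hlogn : Nat.log 2 (2 ^ t) = t := Nat.log_pow Nat.one_lt_two _
  rw [hlogn] at hm
  -- 2^(2^t/3) ≤ m*m ≤ 2^(2 (t+c)^c)
  have hmm : m * m ≤ 2 ^ (2 * (t + c) ^ c) := by
    calc m * m ≤ 2 ^ ((t + c) ^ c) * 2 ^ ((t + c) ^ c) := Nat.mul_le_mul hm hm
      _ = 2 ^ (2 * (t + c) ^ c) := by rw [← pow_add]; ring_nf
  have hle : 2 ^ t / 3 ≤ 2 * (t + c) ^ c :=
    (Nat.pow_le_pow_iff_right Nat.one_lt_two).1 (hlow.trans hmm)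
  have hlt := six_mul_pow_add_three_le_two_pow c
  rw [← ht] at hlt
  omega

end Summit.ValiantsHypothesis.ValiantsHypothesis.Theorems.PolyaContinuedMonotoneCoverHard
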